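import Literature.AnabelianGeometry.AbsoluteAnabelian.AbsTopIProp23iHyperbolicModelProofs
import Literature.AnabelianGeometry.AbsoluteAnabelian.ProfiniteSlimAscent
import Literature.AnabelianGeometry.AbsoluteAnabelian.SlimFiniteNormalProofs
import Literature.AnabelianGeometry.SemiGraphs.ProSigmaSurfaceTypeInvariance
import Literature.AnabelianGeometry.SemiGraphs.ProSigmaCompletionExtend
import Mathlib.GroupTheory.IndexNormal
import HarnessLib

/-!
# Profinite groups with an open index-2 pro-`Σ` surface subgroup under inversion are slim and
# elastic — [AbsTopI] Prop 2.3 (i) for the quotient orbicurve `C = X/⟨±1⟩`, group-theoretic core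

S. Mochizuki, *Topics in Absolute Anabelian Geometry I: Generalities*, J. Math. Sci. Univ. Tokyo 19
(2012) [MochizukiAbsTopI2012], Proposition 2.3 (i) p. 19 (manuscript; lit key `paper:w2145418809`
p. 161): "Let `Δ` be a profinite group of GFG-type that admits partial construction data
`(k, X, Σ)` … such that `X` is a hyperbolic ORBICURVE, and `Σ` contains a prime invertible in `k`.
Then `Δ` is slim and elastic."; §0 p. 8: "every finite normal closed subgroup `N ⊆ G` of a slim
profinite group `G` is trivial".  S. Mochizuki, *The Absolute Anabelian Geometry of Hyperbolic
Curves* (2004) [MochizukiAbsAnab2004], Lemma 1.3.1 p. 15 "`Δ_X`, `Π_X` are slim"; Lemma 1.3.9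
p. 19 "`dim Δ^{ab} ⊗ ℚ_l = 2g − 1 + r` (resp. `2g`)".

abc-iut cell, block F seat abc-iut-f-051 (gen 3); PROOF-ONLY (no definition, no named fact).
The tree proves Prop 2.3 (i) / Lemma 1.3.1 AT THE SURFACE-GROUP MODEL of a hyperbolic CURVE
(`Δ` a pro-`Σ` completion of `Γ_{g,r}`: abc-iut-L4-d1, abc-iut-w5-d206,
`AbsTopIProp23iHyperbolicModelProofs`) and, for an OPEN surface subgroup `U ⊆ Δ`, REDUCES it to the
single input «`Δ` has no nontrivial finite normal subgroup» (abc-iut-w6-d071, `ProfiniteSlimAscent`,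
`AbsTopIProp23iAlmostProSigmaModel`).  This file DISCHARGES that input at the simplest ORBICURVE
model — the one [IUTchI] Def. 3.1 (b) uses (`C_F := X_F // {±1}`, `[Π_{C_F} : Π_{X_F}] = 2`):

  `Δ` profinite, `N ⊆ Δ` an OPEN subgroup of index `2` presented as a pro-`Σ` completion
  `ι : Γ_{g,r} → N` of a HYPERBOLIC surface group (`Σ` a nonempty set of primes), such that every
  `z ∈ Δ ∖ N` acts on `N^{ab}` by INVERSION: `z x z⁻¹ x ∈ closure [N, N]` for all `x ∈ N`

(the shape of `Δ_C ⊇ Δ_X` for `C = X/⟨ι⟩`, `ι` an involution acting as `−1` on `H₁(X)`: the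
elliptic involution `P ↦ −P` of `E ∖ {O}`, a hyperelliptic involution of a closed curve).

* `PuncturedSurfaceGroup.exists_monoidHom_zmod_apply_eq_ofAdd_one` — for hyperbolic `(g, r)` and
  every `n`, a character `Γ_{g,r} → ℤ/n` taking the value `1`;
* `IsProSigmaCompletion.exists_mul_self_not_mem_topologicalClosure_commutator` — in a pro-`Σ`
  completion `P` of a hyperbolic `Γ_{g,r}` some square lies OUTSIDE the closed commutator subgroup
  (the character above, extended continuously to `P → ℤ/l²`, `l ∈ Σ`, by abc-iut's
  `exists_continuous_extend_top`);
* `mem_topologicalClosure_iff_coe_mem`, `mem_topologicalClosure_commutator_iff` — closures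
  computed in a subgroup vs. in the ambient group;
* `forall_finite_normal_eq_bot_of_indexTwoInv` — at the model, `Δ` has NO nontrivial finite normal
  subgroup: such an `F` meets the slim `N` trivially (`eq_bot_of_finite_normal_of_isSlimGroup`), so
  an element `z ∈ F ∖ N` would be central, hence centralise `N`, forcing EVERY square of `N` into
  `closure [N, N]` — contradicting the second item;
* `isSlimGroup_of_indexTwoInv`, `slim_and_elastic_of_indexTwoInv` — `Δ` is slim, and slim ∧
  elastic, by the ascent theorems over the surface-group model theorems for `N`
  (`slim_and_elastic_subgroup_of_isProSigmaCompletion_hyperbolic`).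

The `FundamentalExtension` instance forms (FACT-LIST F-0004 `GeomAndArithSlim`, F-0239
`GeomSlimElastic`) are in the companion `AbsAnabFundamentalGroupsOrbicurveModelProofs.lean`.
HONEST SCOPE: plain (pro)finite group theory composed with landed theorems; print's Prop 2.3 (i)
covers all hyperbolic orbicurves, this covers quotients of curves by an involution acting by
inversion on `Δ_X^{ab}`.  Classical anabelian preliminaries — nothing here bears on [IUTchIII]
Cor. 3.12 or takes a side; typed ≠ proved elsewhere.
-/

noncomputable section

open Topology

universe u

/-! ### A character of `Γ_{g,r}` with value `1` -/

namespace Literature.GroupTheory.CombinatorialGroupTheory.PuncturedSurfaceGroup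

variable {g r : ℕ}

/-- For a hyperbolic type `(g, r)` (`2g − 2 + r > 0`, so `g ≥ 1` or `r ≥ 3`) and every `n`, there
is a homomorphism `Γ_{g,r} → ℤ/n` taking the value `1` on some element: `a₁ ↦ 1` (other generators
`↦ 0`) if `g ≥ 1`, else `c₁ ↦ 1, c₂ ↦ −1` (other `cⱼ ↦ 0`); the relator maps to `∑ⱼ cⱼ = 0`
(`lift_relator_eq_prod`).  ("`dim Δ^{ab} = 2g − 1 + r` … `> 0`".)
[cite: MochizukiAbsAnab2004, Lemma 1.3.9 p.19] -/
theorem exists_monoidHom_zmod_apply_eq_ofAdd_one (h : IsHyperbolicType g r) (n : ℕ) :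
    ∃ (f : PuncturedSurfaceGroup g r →* Multiplicative (ZMod n)) (γ : PuncturedSurfaceGroup g r),
      f γ = Multiplicative.ofAdd 1 := by
  classical
  by_cases hg : 0 < g
  · -- `a₀ ↦ 1`, every other generator `↦ 0`
    let i₀ : Fin g := ⟨0, hg⟩
    let F : puncturedSurfaceGen g r → Multiplicative (ZMod n) :=
      Sum.elim (fun x => if x = (i₀, false) then Multiplicative.ofAdd 1 else 1) (fun _ => 1)
    have hrel : ∀ w ∈ ({relator g r} : Set (FreeGroup (puncturedSurfaceGen g r))),
        FreeGroup.lift F w = 1 := by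
      intro w hw
      rw [Set.mem_singleton_iff.mp hw, lift_relator_eq_prod]
      exact Finset.prod_eq_one fun j _ => rfl
    refine ⟨PresentedGroup.toGroup hrel, a i₀, ?_⟩
    change PresentedGroup.toGroup hrel (PresentedGroup.of (Sum.inl (i₀, false))) = _
    rw [PresentedGroup.toGroup.of]
    simp [F]
  · -- `g = 0`, hence `r ≥ 3`: `c₀ ↦ 1`, `c₁ ↦ −1`, every other generator `↦ 0`
    have hr : 3 ≤ r := by unfold IsHyperbolicType at h; omega
    let j₀ : Fin r := ⟨0, by omega⟩
    let j₁ : Fin r := ⟨1, by omega⟩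
    have hj : j₀ ≠ j₁ := by
      intro hj
      have := congrArg Fin.val hj
      simp [j₀, j₁] at this
    let F : puncturedSurfaceGen g r → Multiplicative (ZMod n) :=
      Sum.elim (fun _ => 1) (fun j => if j = j₀ then Multiplicative.ofAdd 1
        else if j = j₁ then Multiplicative.ofAdd (-1) else 1)
    have hrel : ∀ w ∈ ({relator g r} : Set (FreeGroup (puncturedSurfaceGen g r))),
        FreeGroup.lift F w = 1 := by
      intro w hw
      rw [Set.mem_singleton_iff.mp hw, lift_relator_eq_prod,
        Finset.prod_eq_mul j₀ j₁ hj (fun c _ hc => by simp [F, hc.1, hc.2]) (by simp) (by simp)]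
      simp [F, hj.symm]
    refine ⟨PresentedGroup.toGroup hrel, c j₀, ?_⟩
    change PresentedGroup.toGroup hrel (PresentedGroup.of (Sum.inr j₀)) = _
    rw [PresentedGroup.toGroup.of]
    simp [F]

end Literature.GroupTheory.CombinatorialGroupTheory.PuncturedSurfaceGroup

/-! ### Squares outside the closed commutator subgroup of a pro-`Σ` surface group -/

namespace Literature.AnabelianGeometry.SemiGraphs.SemiGraphOfAnabelioids.IsProSigmaCompletion

open Literature.AnabelianGeometry.Anabelioids
open Literature.GroupTheory.CombinatorialGroupTheory

variable {Sigma : Set ℕ} {P : Type*} [Group P] [TopologicalSpace P] [IsTopologicalGroup P]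
  [CompactSpace P] [TotallyDisconnectedSpace P] {g r : ℕ} {ι : PuncturedSurfaceGroup g r →* P}

/-- **In a pro-`Σ` completion `P` of a hyperbolic `Γ_{g,r}` (`Σ` a nonempty set of primes) some
square `x²` lies outside the closed commutator subgroup** `closure [P, P]` — i.e. `P^{ab}` is not
killed by `2`: the character `Γ_{g,r} → ℤ/l²` with value `1` (`l ∈ Σ`) extends to a continuous
`F : P → ℤ/l²` (`exists_continuous_extend_top`) killing `closure [P, P]`, and `F(x²) = 2 ≠ 0`.
("`dim Δ^{ab} ⊗ ℚ_l = 2g − 1 + r` (resp. `2g`)" is positive for a hyperbolic type.)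
[cite: MochizukiAbsAnab2004, Lemma 1.3.9 p.19] [cite: MochizukiSemiAnbd2006, Ex. 2.10 p.31] -/
theorem exists_mul_self_not_mem_topologicalClosure_commutator (hι : IsProSigmaCompletion Sigma ι)
    (hS : Sigma.Nonempty) (hSp : ∀ p ∈ Sigma, p.Prime)
    (hgr : PuncturedSurfaceGroup.IsHyperbolicType g r) :
    ∃ x : P, x * x ∉ (commutator P).topologicalClosure := by
  classical
  obtain ⟨l, hlS⟩ := hS
  have hl : l.Prime := hSp l hlS
  haveI : NeZero (l ^ 2) := ⟨pow_ne_zero 2 hl.ne_zero⟩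
  letI : TopologicalSpace (Multiplicative (ZMod (l ^ 2))) := ⊥
  haveI : DiscreteTopology (Multiplicative (ZMod (l ^ 2))) := ⟨rfl⟩
  haveI : Finite (Multiplicative (ZMod (l ^ 2))) := Finite.of_equiv _ Multiplicative.ofAdd
  have hQ : IsSigmaInteger Sigma (Nat.card (Multiplicative (ZMod (l ^ 2)))) := by
    rw [Nat.card_congr Multiplicative.toAdd, Nat.card_zmod]
    exact ⟨pow_pos hl.pos 2, fun p hp hpl => by
      rwa [(Nat.prime_dvd_prime_iff_eq hp hl).mp (hp.dvd_of_dvd_pow hpl)]⟩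
  obtain ⟨f, γ, hfγ⟩ :=
    PuncturedSurfaceGroup.exists_monoidHom_zmod_apply_eq_ofAdd_one hgr (l ^ 2)
  obtain ⟨F, hFc, hF⟩ := exists_continuous_extend_top hι hQ f
  refine ⟨ι γ, fun hmem => ?_⟩
  -- `F` kills the closed commutator subgroup
  have hcl : IsClosed ((F.ker : Subgroup P) : Set P) := by
    rw [MonoidHom.coe_ker]
    exact (isClosed_discrete _).preimage hFc
  have hker : (commutator P).topologicalClosure ≤ F.ker :=
    Subgroup.topologicalClosure_minimal _ (Abelianization.commutator_subset_ker F) hcl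
  have h1 : F (ι γ * ι γ) = 1 := hker hmem
  rw [map_mul, hF γ, hfγ, ← ofAdd_add, ← ofAdd_zero, Multiplicative.ofAdd.apply_eq_iff_eq,
    one_add_one_eq_two] at h1
  -- `(2 : ℤ/l²) = 0` forces `l² ∣ 2`, impossible for a prime `l`
  have h2 : (l ^ 2) ∣ 2 := (ZMod.natCast_eq_zero_iff 2 (l ^ 2)).mp (by exact_mod_cast h1)
  have h3 : l ^ 2 ≤ 2 := Nat.le_of_dvd two_pos h2
  have h4 : 2 ^ 2 ≤ l ^ 2 := Nat.pow_le_pow_left hl.two_le 2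
  omega

end Literature.AnabelianGeometry.SemiGraphs.SemiGraphOfAnabelioids.IsProSigmaCompletion

namespace Literature.AnabelianGeometry.AbsoluteAnabelian

open Literature.AlgebraicGeometry.Frobenioids (IsSlimGroup)
open Literature.AnabelianGeometry.SemiGraphs.SemiGraphOfAnabelioids
open Literature.GroupTheory.CombinatorialGroupTheory

/-! ### Closures inside a subgroup -/

section Transfer

variable {G : Type u} [Group G] [TopologicalSpace G] [IsTopologicalGroup G]

/-- For a subgroup `K ⊆ G` and `S ⊆ K`, membership in the closure of `S` computed in `K` is
membership in the closure of `S` computed in `G` (`K ↪ G` is an embedding; plumbing for the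
index-two model of Prop 2.3 (i)). [cite: MochizukiAbsTopI2012, Prop 2.3 (i) p.19] -/
theorem mem_topologicalClosure_iff_coe_mem (K : Subgroup G) (S : Subgroup K) (y : K) :
    y ∈ S.topologicalClosure ↔ (y : G) ∈ (S.map K.subtype).topologicalClosure := by
  rw [← SetLike.mem_coe, Subgroup.topologicalClosure_coe,
    Topology.IsEmbedding.subtypeVal.closure_eq_preimage_closure_image, Set.mem_preimage,
    ← SetLike.mem_coe, Subgroup.topologicalClosure_coe, Subgroup.coe_map, Subgroup.coe_subtype]

/-- In particular for the commutator subgroup: `y ∈ closure [K, K]` (in `K`) iff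
`y ∈ closure [K, K]` (in `G`; plumbing for the index-two model of Prop 2.3 (i)).
[cite: MochizukiAbsTopI2012, Prop 2.3 (i) p.19] -/
theorem mem_topologicalClosure_commutator_iff (K : Subgroup G) (y : K) :
    y ∈ (commutator K).topologicalClosure ↔ (y : G) ∈ (⁅K, K⁆ : Subgroup G).topologicalClosure := by
  rw [mem_topologicalClosure_iff_coe_mem, Subgroup.map_subtype_commutator]

end Transfer

/-! ### The index-two model: no finite normal subgroups, slimness, elasticity -/

section IndexTwoInv

variable {Δ : Type u} [Group Δ] [TopologicalSpace Δ] [IsTopologicalGroup Δ] [CompactSpace Δ]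
  [T2Space Δ] [TotallyDisconnectedSpace Δ] {Sigma : Set ℕ} {g r : ℕ}

/-- The surface-group model on an OPEN subgroup: if `N ⊆ Δ` is open and presented as a pro-`Σ`
completion of a hyperbolic `Γ_{g,r}` (`Σ` a nonempty set of primes), then `N` is slim and elastic
(closed class abc-iut-L4-d1, punctured class abc-iut-w5-d206, BY NAME).
[cite: MochizukiAbsTopI2012, Prop 2.3 (i) p.19] -/
theorem slim_and_elastic_subgroup_of_isProSigmaCompletion_hyperbolic (N : Subgroup Δ)
    (hNo : IsOpen (N : Set Δ)) (hS : Sigma.Nonempty) (hSp : ∀ p ∈ Sigma, p.Prime)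
    (hgr : PuncturedSurfaceGroup.IsHyperbolicType g r) (ι : PuncturedSurfaceGroup g r →* N)
    (hι : IsProSigmaCompletion Sigma ι) : IsSlimGroup N ∧ IsElastic N := by
  haveI : CompactSpace N :=
    isCompact_iff_compactSpace.mp (Subgroup.isClosed_of_isOpen N hNo).isCompact
  rcases Nat.eq_zero_or_pos r with hr | hr
  · subst hr
    exact IsProSigmaCompletion.slim_and_elastic_of_isProSigmaCompletion_closedSurfaceGroup Sigma hS
      hSp g (FundamentalExtension.two_le_genus_of_isHyperbolicType_zero hgr) N ι hι
  · obtain ⟨l, hlS⟩ := hS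
    exact slim_and_elastic_of_isProSigmaCompletion_puncturedSurfaceGroup hr hgr hι
      ⟨l, hlS, hSp l hlS⟩

/-- **No nontrivial finite normal subgroup at the index-two model.**  Let `Δ` be profinite,
`N ⊆ Δ` an open subgroup of index `2` presented as a pro-`Σ` completion of a hyperbolic `Γ_{g,r}`
(`Σ` a nonempty set of primes), and suppose every `z ∈ Δ ∖ N` acts on `N^{ab}` by inversion
(`z x z⁻¹ x ∈ closure [N, N]` for `x ∈ N`).  Then every finite normal subgroup `F ⊆ Δ` is trivial:
`F ∩ N` is a finite normal subgroup of the slim group `N`, hence trivial ([AbsTopI] §0,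
`eq_bot_of_finite_normal_of_isSlimGroup`); so `z ∈ F ∖ N` would have all its commutators
`y z y⁻¹ z⁻¹ ∈ F ∩ N = 1`, i.e. be CENTRAL, hence centralise `N`, whence `x² ∈ closure [N, N]`
for every `x ∈ N` — contradicting `exists_mul_self_not_mem_topologicalClosure_commutator`.  This is
the residual input of the tree's almost pro-`Σ` model (`AbsTopIProp23iAlmostProSigmaModel`),
discharged here. [cite: MochizukiAbsTopI2012, Prop 2.3 (i) p.19] -/
theorem forall_finite_normal_eq_bot_of_indexTwoInv (N : Subgroup Δ) (hNo : IsOpen (N : Set Δ))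
    (hN2 : N.index = 2) (hS : Sigma.Nonempty) (hSp : ∀ p ∈ Sigma, p.Prime)
    (hgr : PuncturedSurfaceGroup.IsHyperbolicType g r) (ι : PuncturedSurfaceGroup g r →* N)
    (hι : IsProSigmaCompletion Sigma ι)
    (hinv : ∀ z : Δ, z ∉ N → ∀ x ∈ N, z * x * z⁻¹ * x ∈ (⁅N, N⁆ : Subgroup Δ).topologicalClosure) :
    ∀ F : Subgroup Δ, F.Normal → (F : Set Δ).Finite → F = ⊥ := by
  intro F hFn hFfin
  haveI : CompactSpace N :=
    isCompact_iff_compactSpace.mp (Subgroup.isClosed_of_isOpen N hNo).isCompact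
  haveI : N.Normal := Subgroup.normal_of_index_eq_two hN2
  have hNslim : IsSlimGroup N :=
    (slim_and_elastic_subgroup_of_isProSigmaCompletion_hyperbolic N hNo hS hSp hgr ι hι).1
  -- Step 1: `F ∩ N = 1`
  have hFN : ∀ z ∈ F, z ∈ N → z = 1 := by
    have hfin' : ((F.subgroupOf N : Subgroup N) : Set N).Finite := by
      rw [Subgroup.coe_subgroupOf]
      exact hFfin.preimage Subtype.val_injective.injOn
    haveI : (F.subgroupOf N).Normal := hFn.subgroupOf N
    have h := eq_bot_of_finite_normal_of_isSlimGroup hNslim (F.subgroupOf N) hfin'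
    intro z hzF hzN
    have hz : (⟨z, hzN⟩ : N) ∈ F.subgroupOf N := by
      rw [Subgroup.mem_subgroupOf]
      exact hzF
    rw [h, Subgroup.mem_bot] at hz
    exact congrArg Subtype.val hz
  -- Step 2: an element of `F` outside `N` would be central, hence centralise `N`
  rw [eq_bot_iff]
  intro z hzF
  rw [Subgroup.mem_bot]
  by_cases hzN : z ∈ N
  · exact hFN z hzF hzN
  exfalso
  have hcomm : ∀ y : Δ, y * z = z * y := by
    intro y
    have h1 : y * z * y⁻¹ * z⁻¹ ∈ F := F.mul_mem (hFn.conj_mem z hzF y) (F.inv_mem hzF)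
    have h2 : y * z * y⁻¹ * z⁻¹ ∈ N := by
      rw [Subgroup.mul_mem_iff_of_index_two hN2]
      refine iff_of_false (fun h => hzN ?_) (fun h => hzN (N.inv_mem_iff.mp h))
      have h' := (inferInstance : N.Normal).conj_mem _ h y⁻¹
      have hyz : y⁻¹ * (y * z * y⁻¹) * y⁻¹⁻¹ = z := by group
      rwa [hyz] at h'
    have h3 : y * z * y⁻¹ * z⁻¹ = 1 := hFN _ h1 h2
    calc y * z = y * z * y⁻¹ * z⁻¹ * (z * y) := by group
      _ = z * y := by rw [h3, one_mul]
  have hsq : ∀ x : N, x * x ∈ (commutator N).topologicalClosure := by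
    intro x
    rw [mem_topologicalClosure_commutator_iff, Subgroup.coe_mul]
    have hx := hinv z hzN x x.2
    rwa [← hcomm (x : Δ), mul_inv_cancel_right] at hx
  obtain ⟨x, hx⟩ :=
    IsProSigmaCompletion.exists_mul_self_not_mem_topologicalClosure_commutator hι hS hSp hgr
  exact hx (hsq x)

/-- **Slimness at the index-two model** ([AbsAnab] Lemma 1.3.1 "`Δ_X` is slim" / [AbsTopI]
Prop 2.3 (i), slimness half, for the quotient orbicurve `C = X/⟨±1⟩`): with `Δ`, `N`, `ι` and the
inversion hypothesis as in `forall_finite_normal_eq_bot_of_indexTwoInv`, `Δ` is slim — `N` is slim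
at the surface-group model, and slimness ascends along the open `N ⊆ Δ` once `Δ` has no nontrivial
finite normal subgroup (`isSlimGroup_of_isOpen_slim_of_forall_finite_normal_eq_bot`, abc-iut-w6-d071).
[cite: MochizukiAbsAnab2004, Lemma 1.3.1 p.15] [cite: MochizukiAbsTopI2012, Prop 2.3 (i) p.19] -/
theorem isSlimGroup_of_indexTwoInv (N : Subgroup Δ) (hNo : IsOpen (N : Set Δ)) (hN2 : N.index = 2)
    (hS : Sigma.Nonempty) (hSp : ∀ p ∈ Sigma, p.Prime)
    (hgr : PuncturedSurfaceGroup.IsHyperbolicType g r) (ι : PuncturedSurfaceGroup g r →* N)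
    (hι : IsProSigmaCompletion Sigma ι)
    (hinv : ∀ z : Δ, z ∉ N → ∀ x ∈ N, z * x * z⁻¹ * x ∈ (⁅N, N⁆ : Subgroup Δ).topologicalClosure) :
    IsSlimGroup Δ :=
  isSlimGroup_of_isOpen_slim_of_forall_finite_normal_eq_bot N hNo
    (slim_and_elastic_subgroup_of_isProSigmaCompletion_hyperbolic N hNo hS hSp hgr ι hι).1
    (forall_finite_normal_eq_bot_of_indexTwoInv N hNo hN2 hS hSp hgr ι hι hinv)

/-- **Slim ∧ elastic at the index-two model** ([AbsTopI] Prop 2.3 (i) "`Δ` is slim and elastic"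
for the quotient orbicurve `C = X/⟨±1⟩`): as above, with elasticity ascending along the open
slim-and-elastic `N ⊆ Δ` (`slim_and_elastic_of_isOpen`, abc-iut-w6-d071).
[cite: MochizukiAbsTopI2012, Prop 2.3 (i) p.19] -/
theorem slim_and_elastic_of_indexTwoInv (N : Subgroup Δ) (hNo : IsOpen (N : Set Δ))
    (hN2 : N.index = 2) (hS : Sigma.Nonempty) (hSp : ∀ p ∈ Sigma, p.Prime)
    (hgr : PuncturedSurfaceGroup.IsHyperbolicType g r) (ι : PuncturedSurfaceGroup g r →* N)
    (hι : IsProSigmaCompletion Sigma ι)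
    (hinv : ∀ z : Δ, z ∉ N → ∀ x ∈ N, z * x * z⁻¹ * x ∈ (⁅N, N⁆ : Subgroup Δ).topologicalClosure) :
    IsSlimGroup Δ ∧ IsElastic Δ :=
  have hN := slim_and_elastic_subgroup_of_isProSigmaCompletion_hyperbolic N hNo hS hSp hgr ι hι
  slim_and_elastic_of_isOpen N hNo hN.1 hN.2
    (forall_finite_normal_eq_bot_of_indexTwoInv N hNo hN2 hS hSp hgr ι hι hinv)

end IndexTwoInv

end Literature.AnabelianGeometry.AbsoluteAnabelian

end
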